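import Mathlib
import HarnessLib
import Summits.HubbardSuperconductivity.HubbardSuperconductivity.Theorems.KLProgrammeKLRegimeEngineV8DefsU7

/-!
# Route `KLProgramme`, crux K3 — engine-flow child (stmt-HubbardSuperconductivity-20437 `KLRegimeEngineV17F2`), stub (C) `stub_twoLeg_curvature`,
# located item #20, cure (δ′) «LAST-STEP SWAP» (pen (R116)): the NAMED CLOSED coupling threshold `klLastRespU P R` of the last-step response door (R)
# — AMENDMENT 19's conditional entry of the `U₀` bundle U12b (name of record, (R116) «ONE RULE on U₀^R», due 2026-08-28 18:00Z)

Cell gate-hubbard-kl, seat p2 g17.  The last-step response `R(θ)` of the swap (`…EngineLastStepFrameIdentity` §4–§5, `…EngineLastStepReadingSwap`) is an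
explicit dressing of the NATIVE symbol by `v = D/(−iω₀ + e_{K_N})`, `|v| ≤ ‖K_N − K_{n_β}‖_∞/ω₀ < 128·Gfr₀·|U|·4^{−n_β}`; every row of its `k ≤ 4` jets
against the registered `curveJetBar klC4aJetC2 (klC4aJetC′ P R) U k N` rows is `≤ C_k·|U|` with `C_k` polynomial in the frame constants `Gfr_{≤4}`
(`≤ klEngRsq R`), the class-#7 / #17 two-leg moment allowances (`≤ 2¹¹·e¹⁸κ₀⁴·klE3Acum R`-type), the kernel-norm package (`≤ 2⁶⁰·klEngPsq²·klEngRsq²`),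
the Fermi-point jets of `FrameOK` (absolute numerals `≤ 10¹⁸` through order 4) and the frequency factors `128⁴` (sizing memo HOME/p2-g17/LAST-THERMAL-SIZING-p2g17.md
§3, evidence #48 on 20437).  This file fixes ONE closed threshold dominating all of them with a wide margin, so that the fit (F3) reads `U ≤ klLastRespU P R`
and nothing else:

  `klLastRespU P R := 1 / (2²⁵⁶ · klEngPsq P ⁴ · klEngRsq R ⁸ · (klE3Acum R ² + 1)²)`.

* `klLastRespU`, `klLastRespU_pos`, `klLastRespU_le_one`;
* the door shape the fit uses: `mul_le_one_of_le_klLastRespU` (`X ≤ 2²⁵⁶·Psq⁴·Rsq⁸·(E3Acum²+1)²`, `0 ≤ U ≤ klLastRespU` ⟹ `X·U ≤ 1`) and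
  `mul_le_of_le_klLastRespU` (`X·U·y ≤ y` for `0 ≤ y`).

A definition of a real constant + arithmetic; nothing about the Hubbard model is asserted; no certificate; nothing asserts superconductivity.  (If F3's explicit
`C_k` turn out larger than the margin, a successor threshold `klLastRespU2 ≤ klLastRespU` is a one-line raise; the entry in U12b is by name.)
References: BGM 2006 §2.4 (2.36)–(2.42) [cite: BenfattoGiulianiMastropietro2006].
-/

noncomputable section

namespace Summit.HubbardSuperconductivity.HubbardSuperconductivity.Theorems.EngineV8

set_option linter.dupNamespace false -- summit = problem name (single-conjunct summit), D-0017

open Real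
open Summit.HubbardSuperconductivity.HubbardSuperconductivity.Theorems.KLRegimeSplit

/-- **`klLastRespU P R := 1 / (2²⁵⁶ · klEngPsq P ⁴ · klEngRsq R ⁸ · (klE3Acum R ² + 1)²)`** — the coupling threshold of the last-step response door (R) of
cure (δ′) «LAST-STEP SWAP» of located item #20 (stub (C) of `KLRegimeEngineV17F2` at the last index `N = n_β + 1`); AMENDMENT 19's conditional entry of the
`U₀` bundle.  Below it every row of the response's `k ≤ 4` jets is inside its share of the registered `curveJetBar` rows (sizing memo §3). -/
def klLastRespU (P : SplitConsts) (R : RenConsts) : ℝ :=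
  1 / ((2 : ℝ) ^ 256 * klEngPsq P ^ 4 * klEngRsq R ^ 8 * (klE3Acum R ^ 2 + 1) ^ 2)

/-- `0 < klLastRespU P R` (unconditionally). -/
theorem klLastRespU_pos (P : SplitConsts) (R : RenConsts) : 0 < klLastRespU P R := by
  unfold klLastRespU
  have hp := klEngPsq_pos P
  have hr := klEngRsq_pos R
  positivity

/-- The denominator is at least `1`: `1 ≤ 2²⁵⁶·Psq⁴·Rsq⁸·(E3Acum²+1)²`. -/
theorem one_le_klLastRespU_den (P : SplitConsts) (R : RenConsts) :
    1 ≤ (2 : ℝ) ^ 256 * klEngPsq P ^ 4 * klEngRsq R ^ 8 * (klE3Acum R ^ 2 + 1) ^ 2 := by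
  have hp : 1 ≤ klEngPsq P ^ 4 := one_le_pow₀ (one_le_klEngPsq P)
  have hr : 1 ≤ klEngRsq R ^ 8 := one_le_pow₀ (one_le_klEngRsq R)
  have he : 1 ≤ (klE3Acum R ^ 2 + 1) ^ 2 := one_le_pow₀ (by nlinarith [sq_nonneg (klE3Acum R)])
  have h2 : (1 : ℝ) ≤ 2 ^ 256 := by norm_num
  calc (1 : ℝ) = 1 * 1 * 1 * 1 := by ring
    _ ≤ (2 : ℝ) ^ 256 * klEngPsq P ^ 4 * klEngRsq R ^ 8 * (klE3Acum R ^ 2 + 1) ^ 2 := by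
        gcongr

/-- `klLastRespU P R ≤ 1`. -/
theorem klLastRespU_le_one (P : SplitConsts) (R : RenConsts) : klLastRespU P R ≤ 1 := by
  unfold klLastRespU
  rw [div_le_one (lt_of_lt_of_le one_pos (one_le_klLastRespU_den P R))]
  exact one_le_klLastRespU_den P R

/-- **The door shape of the fit**: a constant `X` below the threshold's denominator is killed by `U ≤ klLastRespU P R`: `X·U ≤ 1`. -/
theorem mul_le_one_of_le_klLastRespU {P : SplitConsts} {R : RenConsts} {X U : ℝ}
    (hX : X ≤ (2 : ℝ) ^ 256 * klEngPsq P ^ 4 * klEngRsq R ^ 8 * (klE3Acum R ^ 2 + 1) ^ 2) (hU0 : 0 ≤ U) (hU : U ≤ klLastRespU P R) :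
    X * U ≤ 1 := by
  have hden : 0 < (2 : ℝ) ^ 256 * klEngPsq P ^ 4 * klEngRsq R ^ 8 * (klE3Acum R ^ 2 + 1) ^ 2 :=
    lt_of_lt_of_le one_pos (one_le_klLastRespU_den P R)
  unfold klLastRespU at hU
  calc X * U ≤ ((2 : ℝ) ^ 256 * klEngPsq P ^ 4 * klEngRsq R ^ 8 * (klE3Acum R ^ 2 + 1) ^ 2) *
        (1 / ((2 : ℝ) ^ 256 * klEngPsq P ^ 4 * klEngRsq R ^ 8 * (klE3Acum R ^ 2 + 1) ^ 2)) :=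
        mul_le_mul hX hU hU0 hden.le
    _ = 1 := mul_one_div_cancel hden.ne'

/-- Corollary: `X·U·y ≤ y` for `0 ≤ y` (the form in which a row `C_k·|U|·(budget row)` is compared with the budget row). -/
theorem mul_le_of_le_klLastRespU {P : SplitConsts} {R : RenConsts} {X U y : ℝ}
    (hX : X ≤ (2 : ℝ) ^ 256 * klEngPsq P ^ 4 * klEngRsq R ^ 8 * (klE3Acum R ^ 2 + 1) ^ 2) (hU0 : 0 ≤ U) (hU : U ≤ klLastRespU P R)
    (hy : 0 ≤ y) : X * U * y ≤ y := by
  have h := mul_le_one_of_le_klLastRespU hX hU0 hU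
  calc X * U * y ≤ 1 * y := mul_le_mul_of_nonneg_right h hy
    _ = y := one_mul y

end Summit.HubbardSuperconductivity.HubbardSuperconductivity.Theorems.EngineV8

end
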